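import Literature.AlgebraicGeometry.FundamentalGroup.EtaleExtensionOfLiftings
import Mathlib.Algebra.TrivSqZeroExt.Ideal
import Mathlib.RingTheory.DualNumber
import HarnessLib

/-!
# Infinitesimal lifting along étale morphisms: nil-thickenings of affine test schemes and `k[ε]`-points

Topic `Literature/AlgebraicGeometry/Morphisms`; theorems only (no definition, no named fact, no
instance).  The infinitesimal lifting property of ÉTALE morphisms in the form in which deformation
arguments consume it: for `f : X ⟶ Y` étale and `φ : R ↠ S` a surjective ring map whose kernel
consists of nilpotent elements (e.g. `(ker φ)ⁿ = 0`, `(ker φ)² = 0`, the augmentation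
`k[ε] ↠ k`), every commutative square
```
Spec S --b--> X
  |Spec φ     |f   (étale)
  v           v
Spec R --a--> Y
```
has a UNIQUE diagonal `a' : Spec R ⟶ X` (EGA IV₄ Déf. (17.1.1)/(17.3.1): étale = formally étale +
locally of finite presentation, and formal étaleness extends from square-zero to nilpotent
thickenings of affine schemes, [GortzWedhorn2023] Def. 18.3, Remark 18.4 (2), Def. 18.34; SGA 1 I
Cor. 5.6, «théorème de prolongement des relèvements»).  In particular a `k[ε]`-point of `Y` together
with a `k`-point of `X` above its closed point lifts to a unique `k[ε]`-point of `X` — an étale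
morphism induces bijections on tangent spaces read as `k[ε]`-points ([GortzWedhorn2020] (6.4),
Prop. 6.7 (p. 152)).

Everything is a corollary of the tree's SGA 1 I 5.6
(`Literature.AlgebraicGeometry.FundamentalGroup.existsUnique_lift_of_etale`, for an arbitrary
SURJECTIVE CLOSED IMMERSION `Y₀ ⟶ Y`): `Spec φ` is a closed immersion (Mathlib
`IsClosedImmersion.spec_of_surjective`) and is surjective exactly when `ker φ ⊆ nilradical R`
(`surjective_specMap_of_ker_le_nilradical`).

* `surjective_specMap_of_ker_le_nilradical`, `le_nilradical_of_isNilpotent`;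
* `exists_unique_lift_of_etale_of_ker_le_nilradical` ⊇ `exists_unique_lift_of_etale_of_isNilpotent`
  ⊇ `exists_unique_lift_of_etale` (square-zero kernel);
* `dualNumber_fst_surjective`, `dualNumber_ker_fst_sq_eq_bot` (Mathlib `TrivSqZeroExt.kerIdeal_sq`),
  `exists_unique_lift_dualNumber_of_etale`, `bijective_comp_dualNumber_of_etale`.

## References
* [EGAIV4] A. Grothendieck, J. Dieudonné, *Éléments de géométrie algébrique* IV₄, Publ. Math. IHÉS
  32 (1967), Déf. (17.1.1) (formellement étale), Déf. (17.3.1) (étale).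
* [SGA1] A. Grothendieck, *Revêtements étales et groupe fondamental* (LNM 224), Exp. I Cor. 5.6.
* [GortzWedhorn2020] U. Görtz, T. Wedhorn, *Algebraic Geometry I*, 2nd ed. (2020), (6.4) and
  Prop. 6.7 (p. 152) (tangent spaces as `k[ε]`-valued points), Cor. 2.11 and Prop. 2.12 (1)
  (`Spec` of a quotient).
* [GortzWedhorn2023] U. Görtz, T. Wedhorn, *Algebraic Geometry II* (2023), Def. 18.3 and
  Remark 18.4 (formally étale; nilpotent thickenings of affine schemes), Def. 18.34 (étale).
* [AtiyahMacdonald1969] M. Atiyah, I. Macdonald, *Introduction to Commutative Algebra*, Prop. 1.8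
  (p. 5).
-/

noncomputable section

open CategoryTheory AlgebraicGeometry
open scoped DualNumber

universe u

namespace Literature.AlgebraicGeometry.Morphisms

/-! ### §1 `Spec` of a surjection with nil kernel is a surjective closed immersion -/

/-- An ideal some power of which vanishes consists of nilpotent elements: `Iⁿ = 0 ⇒ I ⊆ nil(R)`
(the nilradical is the set of nilpotent elements = the intersection of all primes).
[cite: AtiyahMacdonald1969, Prop. 1.7 and Prop. 1.8 (p. 5)] -/
theorem le_nilradical_of_isNilpotent {R : Type*} [CommSemiring R] {I : Ideal R}
    (hI : IsNilpotent I) : I ≤ nilradical R := by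
  obtain ⟨n, hn⟩ := hI
  exact fun x hx => ⟨n, hn ▸ Ideal.pow_mem_pow hx n⟩

/-- **`Spec` of a surjective ring map with nil kernel is surjective** (its image is the closed set
`V(ker φ)`, which is everything iff `ker φ ⊆ nil(R)`; e.g. `Spec (R/I) → Spec R` for a nilpotent
ideal `I` is a homeomorphism). [cite: GortzWedhorn2020, Cor. 2.11 and Prop. 2.12 (1)] -/
theorem surjective_specMap_of_ker_le_nilradical {R S : CommRingCat.{u}} (φ : R ⟶ S)
    (hφ : Function.Surjective φ.hom) (hker : RingHom.ker φ.hom ≤ nilradical R) :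
    Surjective (Spec.map φ) := by
  refine ⟨fun x => ?_⟩
  have hx : x ∈ Set.range (PrimeSpectrum.comap φ.hom) := by
    rw [range_comap_of_surjective _ _ hφ,
      (PrimeSpectrum.zeroLocus_eq_univ_iff _).mpr (SetLike.coe_subset_coe.mpr hker)]
    exact Set.mem_univ x
  obtain ⟨y, hy⟩ := hx
  exact ⟨y, hy⟩

/-! ### §2 The unique infinitesimal lift along an étale morphism -/

/-- **UNIQUE INFINITESIMAL LIFTING ALONG AN ÉTALE MORPHISM, affine test schemes with nil kernel**:
for `f : X ⟶ Y` étale, `φ : R ↠ S` surjective with `ker φ ⊆ nil(R)`, and `a : Spec R ⟶ Y`,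
`b : Spec S ⟶ X` with `b ≫ f = Spec φ ≫ a`, there is a UNIQUE `a' : Spec R ⟶ X` with
`Spec φ ≫ a' = b` and `a' ≫ f = a`.  (`Spec φ` is a surjective closed immersion, so this is SGA 1 I
Cor. 5.6, the tree's `FundamentalGroup.existsUnique_lift_of_etale`; for `φ` with nilpotent kernel it
is the formal étaleness of étale morphisms, EGA IV₄ Déf. (17.1.1)/(17.3.1).)
[cite: SGA1, Exp. I Cor. 5.6] [cite: EGAIV4, Déf. (17.1.1) and Déf. (17.3.1)] -/
theorem exists_unique_lift_of_etale_of_ker_le_nilradical {X Y : Scheme.{u}} (f : X ⟶ Y) [Etale f]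
    {R S : CommRingCat.{u}} (φ : R ⟶ S) (hφ : Function.Surjective φ.hom)
    (hker : RingHom.ker φ.hom ≤ nilradical R) (a : Spec R ⟶ Y) (b : Spec S ⟶ X)
    (h : b ≫ f = Spec.map φ ≫ a) :
    ∃! a' : Spec R ⟶ X, Spec.map φ ≫ a' = b ∧ a' ≫ f = a := by
  haveI : IsClosedImmersion (Spec.map φ) := IsClosedImmersion.spec_of_surjective φ hφ
  haveI : Surjective (Spec.map φ) := surjective_specMap_of_ker_le_nilradical φ hφ hker
  exact FundamentalGroup.existsUnique_lift_of_etale f (Spec.map φ) b a h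

/-- **Unique infinitesimal lifting along an étale morphism, nilpotent kernel** (`(ker φ)ⁿ = 0`):
EGA IV₄ Déf. (17.1.1) (formally étale = unique lifts along nilpotent thickenings of affine schemes)
with Déf. (17.3.1) (étale = formally étale + locally of finite presentation); [GortzWedhorn2023]
Def. 18.3 (order-one thickenings), Remark 18.4 (2) (⇒ all nilpotent thickenings of affine schemes),
Def. 18.34. [cite: EGAIV4, Déf. (17.1.1) and Déf. (17.3.1)]
[cite: GortzWedhorn2023, Def. 18.3, Remark 18.4 (2) and Def. 18.34] -/
theorem exists_unique_lift_of_etale_of_isNilpotent {X Y : Scheme.{u}} (f : X ⟶ Y) [Etale f]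
    {R S : CommRingCat.{u}} (φ : R ⟶ S) (hφ : Function.Surjective φ.hom)
    (hN : IsNilpotent (RingHom.ker φ.hom)) (a : Spec R ⟶ Y) (b : Spec S ⟶ X)
    (h : b ≫ f = Spec.map φ ≫ a) :
    ∃! a' : Spec R ⟶ X, Spec.map φ ≫ a' = b ∧ a' ≫ f = a :=
  exists_unique_lift_of_etale_of_ker_le_nilradical f φ hφ (le_nilradical_of_isNilpotent hN) a b h

/-- **Unique infinitesimal lifting along an étale morphism, square-zero kernel** (`(ker φ)² = 0`,
the case deformation theory uses: first-order thickenings). [cite: EGAIV4, Déf. (17.1.1) and Déf. (17.3.1)]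
[cite: GortzWedhorn2023, Def. 18.3 and Def. 18.34] [cite: SGA1, Exp. I Cor. 5.6] -/
theorem exists_unique_lift_of_etale {X Y : Scheme.{u}} (f : X ⟶ Y) [Etale f]
    {R S : CommRingCat.{u}} (φ : R ⟶ S) (hφ : Function.Surjective φ.hom)
    (hφ2 : RingHom.ker φ.hom ^ 2 = ⊥) (a : Spec R ⟶ Y) (b : Spec S ⟶ X)
    (h : b ≫ f = Spec.map φ ≫ a) :
    ∃! a' : Spec R ⟶ X, Spec.map φ ≫ a' = b ∧ a' ≫ f = a :=
  exists_unique_lift_of_etale_of_isNilpotent f φ hφ ⟨2, hφ2.trans (Submodule.zero_eq_bot).symm⟩ a b h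

/-! ### §3 The dual numbers: `k[ε]`-points lift uniquely -/

/-- The augmentation `k[ε] → k`, `ε ↦ 0`, is surjective (split by `k ⊆ k[ε]`).
[cite: GortzWedhorn2020, (6.4) (the ring of dual numbers `k[ε]`, p. 152)] -/
theorem dualNumber_fst_surjective (k : Type u) [CommRing k] :
    Function.Surjective (CommRingCat.ofHom (TrivSqZeroExt.fstHom k k k).toRingHom).hom :=
  fun z => ⟨TrivSqZeroExt.inl z, TrivSqZeroExt.fst_inl k z⟩

/-- The augmentation ideal `(ε) ⊆ k[ε]` has square zero (Mathlib `TrivSqZeroExt.kerIdeal_sq`).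
[cite: GortzWedhorn2020, (6.4) (the ring of dual numbers `k[ε]`, `ε² = 0`, p. 152)] -/
theorem dualNumber_ker_fst_sq_eq_bot (k : Type u) [CommRing k] :
    RingHom.ker (CommRingCat.ofHom (TrivSqZeroExt.fstHom k k k).toRingHom).hom ^ 2 = ⊥ :=
  TrivSqZeroExt.kerIdeal_sq k k

/-- **`k[ε]`-points lift uniquely along étale morphisms**: for `f : X ⟶ Y` étale, a `k[ε]`-point
`v : Spec k[ε] ⟶ Y` and a `k`-point `x : Spec k ⟶ X` above the closed point of `v`
(`x ≫ f = Spec(ε ↦ 0) ≫ v`), there is a unique `w : Spec k[ε] ⟶ X` through `x` over `v`.  With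
tangent vectors read as `k[ε]`-points ([GortzWedhorn2020] (6.4), Prop. 6.7) this says that an étale
morphism is bijective on tangent spaces. [cite: GortzWedhorn2020, (6.4) and Prop. 6.7 (p. 152)]
[cite: GortzWedhorn2023, Def. 18.3 and Def. 18.34] [cite: EGAIV4, Déf. (17.1.1) and Déf. (17.3.1)] -/
theorem exists_unique_lift_dualNumber_of_etale {k : Type u} [CommRing k] {X Y : Scheme.{u}}
    (f : X ⟶ Y) [Etale f] (v : Spec (.of k[ε]) ⟶ Y) (x : Spec (.of k) ⟶ X)
    (h : x ≫ f = Spec.map (CommRingCat.ofHom (TrivSqZeroExt.fstHom k k k).toRingHom) ≫ v) :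
    ∃! w : Spec (.of k[ε]) ⟶ X,
      Spec.map (CommRingCat.ofHom (TrivSqZeroExt.fstHom k k k).toRingHom) ≫ w = x ∧ w ≫ f = v :=
  exists_unique_lift_of_etale f _ (dualNumber_fst_surjective k) (dualNumber_ker_fst_sq_eq_bot k) v x h

/-- **An étale morphism is bijective on `k[ε]`-points with prescribed closed point**: for
`f : X ⟶ Y` étale and a `k`-point `x` of `X`, composition with `f` is a bijection from the
`k[ε]`-points of `X` through `x` onto the `k[ε]`-points of `Y` through `x ≫ f` (GW I Prop. 6.7:
`T_x X = X(k[ε])_x`; so an étale morphism induces `T_x X ≅ T_{f x} Y` on rational points).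
[cite: GortzWedhorn2020, (6.4) and Prop. 6.7 (p. 152)] [cite: GortzWedhorn2023, Def. 18.3 and Def. 18.34] -/
theorem bijective_comp_dualNumber_of_etale {k : Type u} [CommRing k] {X Y : Scheme.{u}}
    (f : X ⟶ Y) [Etale f] (x : Spec (.of k) ⟶ X) :
    Function.Bijective (fun w : {w : Spec (.of k[ε]) ⟶ X //
        Spec.map (CommRingCat.ofHom (TrivSqZeroExt.fstHom k k k).toRingHom) ≫ w = x} =>
      (⟨w.1 ≫ f, by rw [← Category.assoc, w.2]⟩ : {v : Spec (.of k[ε]) ⟶ Y //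
        Spec.map (CommRingCat.ofHom (TrivSqZeroExt.fstHom k k k).toRingHom) ≫ v = x ≫ f})) := by
  refine ⟨fun w₁ w₂ hw => ?_, fun v => ?_⟩
  · obtain ⟨w, -, hu⟩ := exists_unique_lift_dualNumber_of_etale f (w₁.1 ≫ f) x
      (by rw [← Category.assoc, w₁.2])
    exact Subtype.ext ((hu w₁.1 ⟨w₁.2, rfl⟩).trans
      (hu w₂.1 ⟨w₂.2, (congrArg Subtype.val hw).symm⟩).symm)
  · obtain ⟨w, ⟨hw₁, hw₂⟩, -⟩ := exists_unique_lift_dualNumber_of_etale f v.1 x v.2.symm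
    exact ⟨⟨w, hw₁⟩, Subtype.ext hw₂⟩

end Literature.AlgebraicGeometry.Morphisms

end
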